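import Summits.HubbardSuperconductivity.HubbardSuperconductivity.Theses.ParityGapRigidity
import Summits.HubbardSuperconductivity.HubbardSuperconductivity.Theses.FluxSpectroscopy
import Literature.MathematicalPhysics.QuantumLattice.HubbardTorusFlux
import Summits.HubbardSuperconductivity.HubbardSuperconductivity.Theorems.ParityGapRigidityIncommensurateRigidityStubUniformYangUpgrade

/-!
# Skeleton of line `registered` for crux `IncommensurateRigidity` — stmt-HubbardSuperconductivity-2195
(route `ParityGapRigidity`, crux rank 2; sub-problem `HubbardSuperconductivity`) — RESHAPE r1

Birth: planner `planner-skel-stmt-HubbardSuperconductivity-2195-0`, 2026-08-17 (skeleton-register),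
published as `Cruxes/IncommensurateRigidity/Lines/birth.lean` (sha 2e65e681e402…); leads gen 0 / c1
kept it verbatim (stubs `stub_kohnStiffness`, `stub_stiffTowerCondensation`).
Reshape r1: line lead `prover-line-stmt-HubbardSuperconductivity-2195-c2-0`, 2026-08-17 (this file).

The crux is the converse Lieb–Schultz–Mattis bet of the route: for every `U > 0` and hole doping
`δ ∈ (0, 1/2)` (non-integer filling `1 - δ` per site), if uniformly in even `L ≥ L₀` every
`(N_L, S^z = 0)`-sector ground state of `hubbardTorus 2 L 1 U`, `N_L = 2⌊(1-δ)L²/2⌋`, has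
(H1) an exponentially decaying one-particle density matrix, (H2) normal fluctuations of every
bounded range-`≤ 1` one-body operator, (H3) at most `D` levels of the sector below `E₀ + c/L`,
(H4) pair-staircase curvature `E(N_L ± 2) - ½[E(N_L) + E(N_L ± 4)] ≤ C/L²`, then every such
ground state has uniform Yang ODLRO `Re v†ρ₂(ψ)v ≥ a L²` for a unit pair wavefunction `v`.

## Reshape r1 (lead c2, 2026-08-17): cut through the programme's EXISTING flux bridge

Why. The birth cut `KohnStiffness → StiffTowerCondensation → crux` factored the crux through the
intermediate datum `FluxStiffness U δ` (`ρ_s θ² ≤ E_L(θ) - E_L(0)` for `|θ| ≤ θ₀`) into two stubs that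
are BOTH open converses (lead c1, `Cruxes/IncommensurateRigidity/LeadReportC1.md`: A = converse LSM
⟹ Meissner stiffness, XL/open; B = "stiff heavy finite tower condenses", returned `stub-blocked: none` by
c1's wave 1). Stub B is, in substance, a private copy of a bet the programme has ALREADY filed twice as a
crux with its own lines and leads: `FluxSpectroscopy.FluxBridge` (stmt-HubbardSuperconductivity-1817: flux
criterion `FC_T` ⟹ macroscopic `ρ₂` eigenpair for every admissible ground-state sequence) and
`EatTheGoldstone.StiffnessForcesCondensation` (stmt-2243). Promoting B to a new item would triplicate it.
Reshape r1 therefore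
* replaces the private datum `FluxStiffness` by the programme's flux criterion `FluxCriterion U δ`
  (= `FluxBridge`'s `FC_T U δ`, written over the named envelope `fluxEnergy`; the route file's inline
  `let ET` is `fluxEnergy` by `rfl`, exactly as in `Cruxes/FluxBridge/Lines/birth.lean`);
* takes the crux `FluxBridge` itself — a REGISTERED OBLIGATION (stmt-1817), not a stub of this line — as
  a hypothesis of the skeleton theorem; progress on 1817 (route FluxSpectroscopy) now propagates here;
* isolates the genuinely provable glue as a registered stub `stub_uniformYangUpgrade` (size M, provable
  now): `FluxBridge`, which is stated PER ADMISSIBLE SEQUENCE with a sequence-dependent constant and in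
  eigenpair form, implies the crux's UNIFORM conclusion `YangODLRO U δ` (one constant `a` for every sector
  ground state at every large even `L`, variational form) under `FluxCriterion U δ` — a diagonal /
  compactness argument: were uniformity to fail, choose ever-worse ground states along a subsequence of
  even sides, complete them to an admissible sequence with arbitrary sector ground states elsewhere
  (`szSector_groundState`: the `(2n, 0)` sector of `hamiltonian G t U` has a ground state whenever
  `n ≤ |Λ|`; here `n = ⌊(1-δ)L²/2⌋ ≤ L²`), apply `FluxBridge` to that sequence and contradict its
  eventual eigenvalue floor `ev ≥ c N_L ≥ c (L²/2 - 2)` (`δ < 1/2`);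
* keeps ONE open core stub, `stub_kohnStiffnessFC : KohnStiffnessFC` — (H1) ∧ (H2) ∧ (H3) ∧ (H4) at
  non-integer filling ⟹ `FluxCriterion U δ` — which is this crux's own content relative to the rest of the
  programme (the Kohn / Scalapino–White–Zhang form of a converse LSM theorem: such a state is not a Kohn
  insulator, quantitatively and up to half a pair flux quantum). It is crux-sized (open; no theorem in print
  gives a stiffness FLOOR from spectral / clustering data — Oshikawa2000, HastingsPRB2004,
  NachtergaeleSimsCMP2007, BachmannEtAl2019/2021 prove only "uniquely gapped ⟹ commensurate", and the
  in-tree `bbdf2019_lsm_filling_hubbardTorus_holds` is that direction). Necessary conditions it must meet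
  are PROVED in `Literature/…/HubbardTorusFluxStiffnessResponse.lean` (lead c1, p148007): `ρ ≤ 2` (Bloch
  ceiling), and zero total `e₁`-current on the whole zero-flux sector ground space at every large even `L`
  (a clause (H1)–(H4) do not visibly supply; the same clause is implicit in `FluxWindow`, stmt-1818).

Composition `IncommensurateRigidity_of : stub_kohnStiffnessFC → stub_uniformYangUpgrade → FluxBridge →
IncommensurateRigidity` is proved below WITHOUT `sorry` (two lines: A gives `FluxCriterion U δ`, the
upgrade turns `FluxBridge` + `FluxCriterion` into `YangODLRO U δ`, which IS the crux's conclusion by `rfl`).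
(H3), (H4) are consumed by stub A only (FluxBridge needs neither); nothing of the crux's hypotheses is dropped.

## Integration r2 (lead c2, 2026-08-17): G closed

Wave 1 of lead c2 landed stub G verbatim as
`Summit.HubbardSuperconductivity.IncommensurateRigidity.Birth.stub_uniformYangUpgrade`
(`Theorems/ParityGapRigidityIncommensurateRigidityStubUniformYangUpgrade.lean`, p151487, ACCEPTED, commit
0d1f68833b96; helpers `exists_unit_isGroundStateInSector_torus`, `re_rayleigh_of_eigen`, …); this file imports it
and the `stub_uniformYangUpgrade` theorem below is a one-line reference (no `sorry`). The ONE remaining `sorry`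
is stub A, `stub_kohnStiffnessFC` — the open core (converse LSM ⟹ `FC_T`). Also landed this cycle (periphery of A,
Literature, p150778, commit e5fb73d2b179): `HubbardTorusFluxLipschitz.lean` — Bloch's theorem at every base flux
and the uniform modulus of continuity `|E_L(Φ) − E_L(Φ')| ≤ 4π²|Φ − Φ'| + 4(Φ − Φ')²` of the flux envelope
(`L ≥ 4`, `0 ≤ δ`, all `U`), hence continuity and uniform equicontinuity in `L`: `FC_T` is a statement about an
equicontinuous, even, `2π`-periodic family, and `KohnStiffnessFC` ⟺ every subsequential (Arzelà–Ascoli) limit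
envelope `e` has `e(θ) ≥ ρ θ²` on `|θ| ≤ π/2` with one `ρ` (a Kohn insulator has `e ≡ 0`).
State of the line: stubs closed {stub_uniformYangUpgrade} / open {stub_kohnStiffnessFC (crux-sized)} / external
{FluxSpectroscopy.FluxBridge = stmt-1817}.

What the birth line could prove is not lost: `FluxCriterion U δ → FluxStiffness U δ` trivially (take
`θ₀ = π/2`), so birth-B composed with r1-A would still give the crux; r1 merely stops carrying B privately.

Disproof used: none relevant — `ledger crux ls stmt-HubbardSuperconductivity-2195` (2026-08-17T08:25Z):
`LeadReportC1.md`, `Lines/birth.lean`, `PICKED.md`; no `Disproof.lean`, no landed `Negative/` lemma.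
Degenerate audit: `FluxCriterion` demands `0 < ρ` and the bound at every `|θ| ≤ π/2` eventually in even
`L` (not vacuous: `θ = π/2` gives `ρ π²/4 ≤ E_L(π/2) - E_L(0)`, false for a Kohn insulator); `YangODLRO`
demands `0 < a`; for even `L ≥ 2` the sector `szSector N_L 0` is non-trivial and `N_L ± 2, N_L ± 4 ≤ 2L²`.
-/

noncomputable section

-- the summit namespace repeats the problem name by design (D-0017)
set_option linter.dupNamespace false

namespace Summit.HubbardSuperconductivity.HubbardSuperconductivity.Cruxes.IncommensurateRigidity.Birth

open scoped BigOperators Matrix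
open Filter
open Literature.MathematicalPhysics.QuantumLattice

/-! ## The crux's hypothesis packages and conclusion (verbatim) -/

/-- (H1) of the crux, verbatim: uniformly in even `L ≥ L₀`, every normalised `(N_L, 0)`-sector
ground state has an exponentially decaying one-particle density matrix. -/
def ExpDecayRDM (U δ : ℝ) : Prop :=
  ∃ C m : ℝ, 0 < m ∧ ∃ L₀ : ℕ, ∀ L ≥ L₀, Even L → ∀ Hm, Hm = hubbardTorus 2 L 1 U → ∀ ψ,
    IsGroundStateInSector Hm (2 * ⌊(1 - δ) * (L : ℝ) ^ 2 / 2⌋₊) 0 ψ → star ψ ⬝ᵥ ψ = 1 →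
    ∀ (x y : FermionTorus 2 L) (σ τ : Fin 2),
      ‖oneParticleRDM ψ (orb x σ) (orb y τ)‖ ≤
        C * Real.exp (-(m * (torusDist x.toTorusSite y.toTorusSite : ℝ)))

/-- (H2) of the crux, verbatim: normal fluctuations `Var_ψ(A) ≤ C L²` of every one-body operator
`A = Σ a(p) c†_{p₁} c_{p₂}` with `|a| ≤ 1` supported on pairs at torus distance `≤ 1`. -/
def NormalFluctuations (U δ : ℝ) : Prop :=
  ∃ C : ℝ, ∃ L₀ : ℕ, ∀ L ≥ L₀, Even L → ∀ Hm, Hm = hubbardTorus 2 L 1 U → ∀ ψ,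
    IsGroundStateInSector Hm (2 * ⌊(1 - δ) * (L : ℝ) ^ 2 / 2⌋₊) 0 ψ → star ψ ⬝ᵥ ψ = 1 →
    ∀ a : Orb (FermionTorus 2 L) × Orb (FermionTorus 2 L) → ℂ, (∀ p, ‖a p‖ ≤ 1) →
      (∀ p, a p ≠ 0 → torusDist (ofLex p.1).1.toTorusSite (ofLex p.2).1.toTorusSite ≤ 1) →
      (expect (Matrix.conjTranspose (∑ p, a p • (creation p.1 * annihilation p.2)) *
          (∑ p, a p • (creation p.1 * annihilation p.2))) ψ).re -
        ‖expect (∑ p, a p • (creation p.1 * annihilation p.2)) ψ‖ ^ 2 ≤ C * (L : ℝ) ^ 2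

/-- (H3) of the crux, verbatim: at most `D` eigenvalues of `H` inside the `(N_L, 0)` sector below
`E₀ + c/L` (variational form: every subspace of the sector with Rayleigh quotients `≤ E₀ + c/L` has
dimension `≤ D`). -/
def FiniteTower (U δ : ℝ) : Prop :=
  ∃ c : ℝ, 0 < c ∧ ∃ D L₀ : ℕ, ∀ L ≥ L₀, Even L → ∀ Hm, Hm = hubbardTorus 2 L 1 U →
    ∀ V : Submodule ℂ (Fock (Orb (FermionTorus 2 L))),
      V ≤ szSector (2 * ⌊(1 - δ) * (L : ℝ) ^ 2 / 2⌋₊) 0 →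
      (∀ φ ∈ V, (star φ ⬝ᵥ Matrix.mulVec Hm φ).re ≤
        (Matrix.minEnergyOn Hm (szSector (2 * ⌊(1 - δ) * (L : ℝ) ^ 2 / 2⌋₊) 0) + c / (L : ℝ)) *
          (star φ ⬝ᵥ φ).re) →
      Module.finrank ℂ V ≤ D

/-- (H4) of the crux, verbatim: pair-staircase curvature `E(N_L ± 2) - ½[E(N_L) + E(N_L ± 4)] ≤ C/L²`
(read correctly: a LOWER bound `≥ -2C/L²` on the step-2 second differences at `N_L ± 2` — it excludes
charge-`4e` staircases; it is NOT an upper bound on the charging energy). -/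
def SoftPairStaircase (U δ : ℝ) : Prop :=
  ∃ C : ℝ, ∃ L₀ : ℕ, ∀ L ≥ L₀, Even L → ∀ Hm, Hm = hubbardTorus 2 L 1 U →
    ∀ (E : ℕ → ℝ) (n : ℕ), E = groundEnergy Hm → n = 2 * ⌊(1 - δ) * (L : ℝ) ^ 2 / 2⌋₊ →
      E (n + 2) - (E n + E (n + 4)) / 2 ≤ C / (L : ℝ) ^ 2 ∧
        E (n - 2) - (E n + E (n - 4)) / 2 ≤ C / (L : ℝ) ^ 2

/-- The crux's conclusion, verbatim: uniform Yang ODLRO of every `(N_L, 0)`-sector ground state. -/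
def YangODLRO (U δ : ℝ) : Prop :=
  ∃ a : ℝ, 0 < a ∧ ∃ L₁ : ℕ, ∀ L ≥ L₁, Even L → ∀ Hm, Hm = hubbardTorus 2 L 1 U → ∀ ψ,
    IsGroundStateInSector Hm (2 * ⌊(1 - δ) * (L : ℝ) ^ 2 / 2⌋₊) 0 ψ → star ψ ⬝ᵥ ψ = 1 →
    ∃ v : Orb (FermionTorus 2 L) × Orb (FermionTorus 2 L) → ℂ,
      star v ⬝ᵥ v = 1 ∧ a * (L : ℝ) ^ 2 ≤ (star v ⬝ᵥ Matrix.mulVec (twoParticleRDM ψ) v).re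

/-! ## The intermediate datum (r1): the programme's flux criterion `FC_T` -/

/-- **The flux criterion `FC_T(U, δ)`** — the hypothesis of `FluxSpectroscopy.FluxBridge` (stmt-1817)
and the torus half of `FluxSpectroscopy.FluxWindow` (stmt-1818), over the NAMED flux envelope
`fluxEnergy L U δ θ = E^T_L(U, δ; θ)` (lowest energy of the seam-twisted torus `hubbardTorusFlux L U θ`
in the `(N_L, 0)` sector; the route file's inline `let ET` is this term by `rfl`): `∃ ρ > 0`, eventually
in even `L`, `ρ θ² ≤ E^T_L(θ) - E^T_L(0)` for all `|θ| ≤ π/2` — an `O(1)` pair stiffness up to half a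
pair flux quantum (excludes Kohn insulators, whose envelope is flat up to `e^{-L/ξ}`, Kohn1964; and
charge-`4e` condensates, flat at `θ = π/2`). Copied verbatim from `Cruxes/FluxBridge/Lines/birth.lean`.
[cite: ScalapinoWhiteZhang1993; ByersYang1961; Kohn1964] -/
def FluxCriterion (U δ : ℝ) : Prop :=
  ∃ ρ : ℝ, 0 < ρ ∧ ∀ᶠ L : ℕ in atTop, ∀ [NeZero L], Even L → ∀ θ : ℝ, |θ| ≤ Real.pi / 2 →
    ρ * θ ^ 2 ≤ fluxEnergy L U δ θ - fluxEnergy L U δ 0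

/-! ## Stub statements (r1) -/

/-- **Stub A (r1) — Kohn–SWZ form of the converse LSM (the open core of this crux).** For every
`U > 0`, `δ ∈ (0, 1/2)`: (H1) ∧ (H2) ∧ (H3) ∧ (H4) uniformly in even `L` ⟹ the flux criterion
`FC_T(U, δ)`. A translation-symmetric (H2), at-most-`D`-degenerate (H3), fermion-gapped (H1) state with
no charge-`4e` staircase (H4) at NON-INTEGER filling `1 - δ` cannot be a Kohn insulator: threading flux
through the `e₁`-cycle must cost `L`-independent energy `≥ ρ θ²` up to `|θ| ≤ π/2`. Mechanism to be
found (Oshikawa / Hastings / Nachtergaele–Sims flux insertion and momentum counting pushed from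
"gapped ⟹ commensurate-or-degenerate" to a stiffness floor); necessary conditions proved in
`HubbardTorusFluxStiffnessResponse.lean` (`ρ ≤ 2`; zero ground-space `e₁`-current).
[cite: Oshikawa2000; HastingsPRB2004; NachtergaeleSimsCMP2007; Kohn1964; ScalapinoWhiteZhang1993;
Watanabe2019] -/
def KohnStiffnessFC : Prop :=
  ∀ (U δ : ℝ), 0 < U → δ ∈ Set.Ioo (0 : ℝ) (1 / 2) →
    ExpDecayRDM U δ → NormalFluctuations U δ → FiniteTower U δ → SoftPairStaircase U δ →
      FluxCriterion U δ

/-- **Stub G (r1) — uniform Yang upgrade (glue; provable now, size M).** The programme's flux bridge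
`FluxSpectroscopy.FluxBridge` (stmt-1817: under `FC_T(U, δ)`, every ADMISSIBLE SEQUENCE of normalised
`(N_L, 0)`-sector ground states has, eventually in even `L`, a unit eigenvector of `ρ₂` with eigenvalue
`≥ c N_L`, `c` depending on the sequence) implies, under `FC_T(U, δ)`, the crux's UNIFORM conclusion
`YangODLRO U δ` (one `a > 0` serving every sector ground state at every large even `L`). Proof: by
contradiction pick ever-worse normalised sector ground states along even sides `L_k ≥ k` (badness
`1/(k+1)`), complete them to an admissible sequence using `szSector_groundState` (a ground state of the
`(2n, 0)` sector exists for `n = ⌊(1-δ)L²/2⌋ ≤ L² = |Λ|`) and normalisation, apply `FluxBridge`, and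
compare its eventual floor `Re v†ρ₂v = ev ≥ c N_L ≥ c (L²/2 - 2)` with the badness `< L²/(k+1)`. -/
def UniformYangUpgrade : Prop :=
  Summit.HubbardSuperconductivity.HubbardSuperconductivity.Theses.FluxSpectroscopy.FluxBridge →
    ∀ (U δ : ℝ), 0 < U → δ ∈ Set.Ioo (0 : ℝ) (1 / 2) → FluxCriterion U δ → YangODLRO U δ

/-! ## Registered stubs

The two stub THEOREMS are stated in TREE VOCABULARY (every constant is a
`Literature.MathematicalPhysics.QuantumLattice`, route-file or Mathlib declaration, short names via the
`open`s above), so that the registered signature elaborates standalone with this file's imports/opens and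
a landed `Theorems/ParityGapRigidityIncommensurateRigidityStub<Name>.lean` can state it verbatim; each is
definitionally (delta) equal to the readable def above (`KohnStiffnessFC`, `UniformYangUpgrade`), which is
what `IncommensurateRigidity_of` consumes through the `__Registered` aliases. -/

/-- Registered stub A (r1) — `KohnStiffnessFC` unfolded: the flux side (converse LSM ⟹ `FC_T`; the hardest
stub, open, held by the lead): for all `U > 0`, `δ ∈ (0,1/2)`, (H1) → (H2) → (H3) → (H4) → `FC_T(U, δ)`. -/
theorem stub_kohnStiffnessFC :
    ∀ (U δ : ℝ), 0 < U → δ ∈ Set.Ioo (0 : ℝ) (1 / 2) →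
      (∃ C m : ℝ, 0 < m ∧ ∃ L₀ : ℕ, ∀ L ≥ L₀, Even L → ∀ Hm, Hm = hubbardTorus 2 L 1 U → ∀ ψ,
        IsGroundStateInSector Hm (2 * ⌊(1 - δ) * (L : ℝ) ^ 2 / 2⌋₊) 0 ψ → star ψ ⬝ᵥ ψ = 1 →
        ∀ (x y : FermionTorus 2 L) (σ τ : Fin 2),
          ‖oneParticleRDM ψ (orb x σ) (orb y τ)‖ ≤
            C * Real.exp (-(m * (torusDist x.toTorusSite y.toTorusSite : ℝ)))) →
      (∃ C : ℝ, ∃ L₀ : ℕ, ∀ L ≥ L₀, Even L → ∀ Hm, Hm = hubbardTorus 2 L 1 U → ∀ ψ,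
        IsGroundStateInSector Hm (2 * ⌊(1 - δ) * (L : ℝ) ^ 2 / 2⌋₊) 0 ψ → star ψ ⬝ᵥ ψ = 1 →
        ∀ a : Orb (FermionTorus 2 L) × Orb (FermionTorus 2 L) → ℂ, (∀ p, ‖a p‖ ≤ 1) →
          (∀ p, a p ≠ 0 → torusDist (ofLex p.1).1.toTorusSite (ofLex p.2).1.toTorusSite ≤ 1) →
          (expect (Matrix.conjTranspose (∑ p, a p • (creation p.1 * annihilation p.2)) *
              (∑ p, a p • (creation p.1 * annihilation p.2))) ψ).re -
            ‖expect (∑ p, a p • (creation p.1 * annihilation p.2)) ψ‖ ^ 2 ≤ C * (L : ℝ) ^ 2) →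
      (∃ c : ℝ, 0 < c ∧ ∃ D L₀ : ℕ, ∀ L ≥ L₀, Even L → ∀ Hm, Hm = hubbardTorus 2 L 1 U →
        ∀ V : Submodule ℂ (Fock (Orb (FermionTorus 2 L))),
          V ≤ szSector (2 * ⌊(1 - δ) * (L : ℝ) ^ 2 / 2⌋₊) 0 →
          (∀ φ ∈ V, (star φ ⬝ᵥ Matrix.mulVec Hm φ).re ≤
            (Matrix.minEnergyOn Hm (szSector (2 * ⌊(1 - δ) * (L : ℝ) ^ 2 / 2⌋₊) 0) + c / (L : ℝ)) *
              (star φ ⬝ᵥ φ).re) →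
          Module.finrank ℂ V ≤ D) →
      (∃ C : ℝ, ∃ L₀ : ℕ, ∀ L ≥ L₀, Even L → ∀ Hm, Hm = hubbardTorus 2 L 1 U →
        ∀ (E : ℕ → ℝ) (n : ℕ), E = groundEnergy Hm → n = 2 * ⌊(1 - δ) * (L : ℝ) ^ 2 / 2⌋₊ →
          E (n + 2) - (E n + E (n + 4)) / 2 ≤ C / (L : ℝ) ^ 2 ∧
            E (n - 2) - (E n + E (n - 4)) / 2 ≤ C / (L : ℝ) ^ 2) →
      ∃ ρ : ℝ, 0 < ρ ∧ ∀ᶠ L : ℕ in atTop, ∀ [NeZero L], Even L → ∀ θ : ℝ, |θ| ≤ Real.pi / 2 →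
        ρ * θ ^ 2 ≤ fluxEnergy L U δ θ - fluxEnergy L U δ 0 := by
  sorry

/-- Registered stub G (r1) — `UniformYangUpgrade` unfolded: sequence-wise flux bridge ⟹ uniform Yang
ODLRO (glue) — **CLOSED** by `Summit.HubbardSuperconductivity.IncommensurateRigidity.Birth.stub_uniformYangUpgrade`
(`Theorems/ParityGapRigidityIncommensurateRigidityStubUniformYangUpgrade.lean`, wave 1 of lead c2, 2026-08-17):
the landed Theorems file proves the registered signature verbatim. -/
theorem stub_uniformYangUpgrade :
    Summit.HubbardSuperconductivity.HubbardSuperconductivity.Theses.FluxSpectroscopy.FluxBridge →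
    ∀ (U δ : ℝ), 0 < U → δ ∈ Set.Ioo (0 : ℝ) (1 / 2) →
      (∃ ρ : ℝ, 0 < ρ ∧ ∀ᶠ L : ℕ in atTop, ∀ [NeZero L], Even L → ∀ θ : ℝ, |θ| ≤ Real.pi / 2 →
          ρ * θ ^ 2 ≤ fluxEnergy L U δ θ - fluxEnergy L U δ 0) →
      ∃ a : ℝ, 0 < a ∧ ∃ L₁ : ℕ, ∀ L ≥ L₁, Even L → ∀ Hm, Hm = hubbardTorus 2 L 1 U → ∀ ψ,
        IsGroundStateInSector Hm (2 * ⌊(1 - δ) * (L : ℝ) ^ 2 / 2⌋₊) 0 ψ → star ψ ⬝ᵥ ψ = 1 →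
        ∃ v : Orb (FermionTorus 2 L) × Orb (FermionTorus 2 L) → ℂ,
          star v ⬝ᵥ v = 1 ∧ a * (L : ℝ) ^ 2 ≤ (star v ⬝ᵥ Matrix.mulVec (twoParticleRDM ψ) v).re :=
  -- CLOSED (wave 1, lead c2): the landed Theorems file proves the registered signature verbatim.
  Summit.HubbardSuperconductivity.IncommensurateRigidity.Birth.stub_uniformYangUpgrade

/-- Stub A in the readable form consumed by the composition (delta-equal to the registered theorem). -/
theorem kohnStiffnessFC_of_stub : KohnStiffnessFC := stub_kohnStiffnessFC

/-- Stub G in the readable form consumed by the composition (delta-equal to the registered theorem). -/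
theorem uniformYangUpgrade_of_stub : UniformYangUpgrade := stub_uniformYangUpgrade

/-! ## Name-keyed aliases of the stub statements — the hypotheses of `IncommensurateRigidity_of`

The native skeleton audit (`#h21_check_skeleton`) admits a hypothesis of the skeleton theorem only if
its head constant is a registered obligation or is NAMED like a declared stub; `__Registered.stub_X`
is the statement of `stub_X` under that name. Each alias is `rfl`-equal to its statement. The third
hypothesis, `FluxSpectroscopy.FluxBridge`, is a registered obligation (stmt-HubbardSuperconductivity-1817). -/
namespace __Registered

/-- Alias of `KohnStiffnessFC` keyed by the registered stub name. -/
abbrev stub_kohnStiffnessFC : Prop := KohnStiffnessFC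

end __Registered

/-! ## Composition: the crux BY NAME from the open stub statement and `FluxBridge` (no `sorry` below)

(r2: G is closed and used as a LEMMA, no longer a hypothesis — as in `Cruxes/GappedWindow/Lines/birth.lean` r2.) -/

/-- **IncommensurateRigidity_of** (r2) — flux side (A), then the programme's flux bridge (stmt-1817)
upgraded to the uniform conclusion by the CLOSED glue G (`uniformYangUpgrade_of_stub`, p151487): given
`U, δ` and the crux's hypotheses (H1)–(H4) (which ARE `ExpDecayRDM`, `NormalFluctuations`, `FiniteTower`,
`SoftPairStaircase` by `rfl`), (A) yields `FluxCriterion U δ`, and G turns `FluxBridge` + `FluxCriterion U δ`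
into the crux's conclusion (which IS `YangODLRO U δ` by `rfl`). Hypotheses = the open stub statement under its
registered name and the registered obligation `FluxSpectroscopy.FluxBridge`; conclusion = the route decl, by name. -/
theorem IncommensurateRigidity_of (hA : __Registered.stub_kohnStiffnessFC)
    (hFB : Summit.HubbardSuperconductivity.HubbardSuperconductivity.Theses.FluxSpectroscopy.FluxBridge) :
    Summit.HubbardSuperconductivity.HubbardSuperconductivity.Theses.ParityGapRigidity.IncommensurateRigidity := by
  intro U δ hU hδ h1 h2 h3 h4
  exact uniformYangUpgrade_of_stub hFB U δ hU hδ (hA U δ hU hδ h1 h2 h3 h4)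

/-- Wiring check (an `example`, so that `IncommensurateRigidity_of` stays the only theorem concluding
the crux): the registered stub feeds the skeleton theorem as stated — given `FluxBridge`, this term
becomes the crux proof when the one `sorry` above is discharged. -/
example (hFB : Summit.HubbardSuperconductivity.HubbardSuperconductivity.Theses.FluxSpectroscopy.FluxBridge) :
    Summit.HubbardSuperconductivity.HubbardSuperconductivity.Theses.ParityGapRigidity.IncommensurateRigidity :=
  IncommensurateRigidity_of kohnStiffnessFC_of_stub hFB

/-- The plain-arrow form `<stub sig> → FluxBridge → IncommensurateRigidity` of the skeleton theorem. -/
example : KohnStiffnessFC →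
    Summit.HubbardSuperconductivity.HubbardSuperconductivity.Theses.FluxSpectroscopy.FluxBridge →
    Summit.HubbardSuperconductivity.HubbardSuperconductivity.Theses.ParityGapRigidity.IncommensurateRigidity :=
  IncommensurateRigidity_of

/-- The three-hypothesis form of r1 is still available (G as an explicit hypothesis). -/
example : KohnStiffnessFC → UniformYangUpgrade →
    Summit.HubbardSuperconductivity.HubbardSuperconductivity.Theses.FluxSpectroscopy.FluxBridge →
    Summit.HubbardSuperconductivity.HubbardSuperconductivity.Theses.ParityGapRigidity.IncommensurateRigidity :=
  fun hA hG hFB U δ hU hδ h1 h2 h3 h4 => hG hFB U δ hU hδ (hA U δ hU hδ h1 h2 h3 h4)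

/-- The hypothesis packages are the crux's, definitionally: the crux unfolds to
`∀ U δ, 0 < U → δ ∈ Ioo 0 (1/2) → (H1) → (H2) → (H3) → (H4) → conclusion`. -/
example :
    Summit.HubbardSuperconductivity.HubbardSuperconductivity.Theses.ParityGapRigidity.IncommensurateRigidity ↔
      ∀ (U δ : ℝ), 0 < U → δ ∈ Set.Ioo (0 : ℝ) (1 / 2) →
        ExpDecayRDM U δ → NormalFluctuations U δ → FiniteTower U δ → SoftPairStaircase U δ →
          YangODLRO U δ :=
  Iff.rfl

/-- `FluxCriterion U δ` IS the flux criterion `FC_T U δ` inlined in `FluxSpectroscopy.FluxBridge`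
(definitional unfolding of `fluxEnergy` / `hubbardTorusFlux`): `FluxBridge` specialises to the form the
upgrade stub consumes. -/
example (hFB : Summit.HubbardSuperconductivity.HubbardSuperconductivity.Theses.FluxSpectroscopy.FluxBridge)
    (U δ : ℝ) (hU : 0 < U) (hδ : δ ∈ Set.Ioo (0 : ℝ) (1 / 2)) (hFC : FluxCriterion U δ)
    (N : ℕ → ℕ) (ψ : ∀ L : ℕ, Fock (Orb (FermionTorus 2 L)))
    (hHyp : ∀ L, Even L → N L = 2 * ⌊(1 - δ) * (L : ℝ) ^ 2 / 2⌋₊ ∧ star (ψ L) ⬝ᵥ ψ L = 1 ∧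
      IsGroundStateInSector (hubbardTorus 2 L 1 U) (N L) 0 (ψ L)) :
    ∃ c : ℝ, 0 < c ∧ ∀ᶠ L : ℕ in atTop, ∀ [NeZero L], Even L →
      ∃ v : Orb (FermionTorus 2 L) × Orb (FermionTorus 2 L) → ℂ, ∃ ev : ℝ,
        star v ⬝ᵥ v = 1 ∧ Matrix.mulVec (twoParticleRDM (ψ L)) v = (ev : ℂ) • v ∧
          c * (N L : ℝ) ≤ ev :=
  hFB U δ hU hδ hFC N ψ hHyp

/-- The birth datum is recovered from the r1 datum: `FC_T` (stiffness on `|θ| ≤ π/2`, eventually in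
even `L`) gives the birth line's `FluxStiffness` (stiffness on `|θ| ≤ θ₀` for all large even `L`) with
`θ₀ = π/2` — so nothing the birth line could prove is lost by r1. -/
example (U δ : ℝ) (h : FluxCriterion U δ) :
    ∃ ρs θ₀ : ℝ, 0 < ρs ∧ 0 < θ₀ ∧ ∃ L₁ : ℕ, ∀ (L : ℕ) [NeZero L], L₁ ≤ L → Even L →
      ∀ θ : ℝ, |θ| ≤ θ₀ → ρs * θ ^ 2 ≤ fluxEnergy L U δ θ - fluxEnergy L U δ 0 := by
  obtain ⟨ρ, hρ, hev⟩ := h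
  obtain ⟨L₁, hL₁⟩ := eventually_atTop.1 hev
  exact ⟨ρ, Real.pi / 2, hρ, by positivity, L₁, fun L _ hL hE θ hθ => hL₁ L hL hE θ hθ⟩

end Summit.HubbardSuperconductivity.HubbardSuperconductivity.Cruxes.IncommensurateRigidity.Birth

end
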